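import Literature.MathematicalPhysics.KineticTheory.InfiniteChainDynamics
import Mathlib.MeasureTheory.Integral.DominatedConvergence
import Mathlib.Analysis.SpecialFunctions.Pow.Real
import HarnessLib

/-!
# The Abelian Green–Kubo witness predicate of the infinite chain: boundary cases and junk analysis

Topic `Literature/MathematicalPhysics/KineticTheory`; API companion of `InfiniteChainDynamics.lean`
for the witness predicate spelled inline by the theses of `AtomisticToContinuum/FouriersLaw`
(`EmbeddedDrudeMourre.GreenKuboContinuation` / `AbelThermodynamicLimit`, stmt-12597 / 12596;
`FourierGreenKubo.FourierGreenKubo`, stmt-0703):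

  `∃ μ D κ, P.IsChainGibbsMeasure T μ ∧ D.PreservesMeasure μ ∧ (∀ t, D.HasAbsConvergentCorrelation μ t)
     ∧ 0 < κ ∧ Tendsto (ν ↦ (T²)⁻¹ ∫_{t>0} e^{-νt} C(t) dt) (𝓝[>] 0) (𝓝 κ)`.

Everything is PROVED (no named fact). Provenance: the load-bearing analysis of the crux
disprover of stmt-12597 (`Summits/AtomisticToContinuum/FouriersLaw/Cruxes/GreenKuboContinuation/Disproof.lean`),
moved here so that theses, ideators and provers can import it.

## Contents

* §1 `T ≤ 0` IS EMPTY. `OscillatorChain.chainSpecification_zero_temp`: for EVERY chain the DLR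
  kernel at `T = 0` on a non-empty volume is the zero measure (junk `0⁻¹ = 0`: weight `e⁰ = 1`
  against the infinite a priori Lebesgue measure, `Measure.tilted` junk); hence
  `OscillatorChain.not_isChainGibbsMeasure_zero_temp` (no chain has a DLR state at `T = 0`). For
  `pinnedChain` with `ω₂, lam, β ≥ 0` the Hamiltonian is `≥ 0`, so negative temperatures are empty
  too (`chainSpecification_pinnedChain_neg_temp`) and `IsChainGibbsMeasure T μ → 0 < T`
  (`isChainGibbsMeasure_pinnedChain_temp_pos`).
* §2 DLR STATES ARE NON-ATOMIC ON COORDINATES. `OscillatorChain.IsChainGibbsMeasure.measure_coord_eq_zero`: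
  `μ {σ | σ 0 = v} = 0`; `not_isChainGibbsMeasure_dirac`.
* §3 THE INTERFACE IS JUNK-INHABITED, THE WITNESS IS NOT. `OscillatorChain.restDynamics` (carrier
  `{rest}`, identity flow) inhabits `InfiniteChainDynamics P` whenever `U'(0) = 0`, preserves
  `Measure.dirac restConfig`, has `C ≡ 0`; `exists_laxAbelWitness`: with "Gibbs" weakened to
  "probability" and `0 < κ` to `0 ≤ κ` a witness exists at EVERY `T` — both clauses are
  load-bearing; `InfiniteChainDynamics.measure_eq_zero_of_carrier_empty`,
  `OscillatorChain.momenta_zero_of_const_isSolution`.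
* §4 OBSTRUCTIONS TO THE ABEL LIMIT. `not_tendsto_abel_of_correlation_zero` (`C ≡ 0`),
  `not_tendsto_abel_of_junk_integral` (non-integrable `e^{-νt}C`: Bochner junk `0` — a witness
  owes measurability/integrability of `t ↦ C(t)`), `not_tendsto_of_drude_floor` (a Drude floor
  `C ≥ d > 0` makes the Abel functional diverge: Mazur charges and the harmonic chain REFUTE
  witnesses), `abelLimit_not_weakly_closed` (Abel limits of Poisson integrals are not closed
  under weak convergence of the spectral measures without an equi-modulus: `δ_{1/(n+1)} ⇀ δ_0`).
* §5 ABEL SUMMATION. `tendsto_abel_of_integrableOn` (`C ∈ L¹(0,∞) ⇒ ∫e^{-νt}C → ∫C`, dominated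
  convergence), `InfiniteChainDynamics.HasGreenKubo.tendsto_abel` (`HasGreenKubo ⇒` the Abel
  functional tends to `κ_GK > 0`: the `L¹` Green–Kubo pair is an Abelian witness).
* §6 ONLY `U, V` MATTER. `OscillatorChain.transportUV` and companions: dynamics, currents, Gibbs
  kernels of two chains with the same potentials coincide (the bath constant `γ` of
  `OscillatorChain` is decoration for every infinite-volume object).

Sources: Bonetto–Lebowitz–Rey-Bellet 2000 §7 eq. (37) (Green–Kubo, `κ_GK`), §6.3 eq. (35)
(Abel/Laplace regularisation of linear response); Lanford–Lebowitz–Lieb 1977 §4 (DLR states of the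
chain); Mazur 1969 (Drude floor). The lemmas themselves are folklore-level measure theory.
-/

noncomputable section

open MeasureTheory Filter Set Topology
open scoped ENNReal
open Literature.Probability.LatticeModels

namespace Literature.MathematicalPhysics.KineticTheory.HeatConduction

/-! ## §1 `T ≤ 0` is empty -/

namespace OscillatorChain

/-- The a priori measure of a non-empty volume has infinite mass (Lebesgue on `(ℝ × ℝ)^Λ`, glued
into the boundary condition). [folklore] -/
theorem map_glue_pi_volume_univ (Λ : Finset ℤ) (hΛ : Λ.Nonempty) (η : ChainConfig) :
    ((Measure.pi fun _ : Λ => (volume : Measure (ℝ × ℝ))).map (glueWith Λ · η)) univ = ∞ := by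
  rw [Measure.map_apply (measurable_glueWith Λ η) MeasurableSet.univ, preimage_univ,
    Measure.pi_univ]
  have hvol : (volume : Measure (ℝ × ℝ)) univ = ∞ := by
    rw [show (univ : Set (ℝ × ℝ)) = univ ×ˢ univ from univ_prod_univ.symm, Measure.volume_eq_prod,
      Measure.prod_prod, Real.volume_univ, ENNReal.top_mul_top]
  simp only [hvol]
  rw [Finset.prod_const, Finset.card_univ]
  apply ENNReal.top_pow
  simp [hΛ.ne_empty]

/-- If the Boltzmann exponent is `≥ 0` pointwise the weight is `≥ 1`, not integrable against the
infinite a priori measure, and `Measure.tilted` returns its junk value `0`. [folklore] -/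
theorem gibbsKernel_eq_zero_of_exponent_nonneg (P : OscillatorChain) (b : ℝ) (Λ : Finset ℤ)
    (hΛ : Λ.Nonempty) (η : ChainConfig)
    (hexp : ∀ σ : ChainConfig, 0 ≤ -b * hamiltonianIn P.chainPotential chainSupp Λ σ) :
    gibbsSpecOfPotential (volume : Measure (ℝ × ℝ)) P.chainPotential chainSupp b Λ η = 0 := by
  simp only [gibbsSpecOfPotential]
  apply tilted_of_not_integrable
  intro hint
  have hfin := hint.hasFiniteIntegral
  simp only [HasFiniteIntegral] at hfin
  have hge : ∫⁻ _σ, (1 : ℝ≥0∞)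
      ∂((Measure.pi fun _ : Λ => (volume : Measure (ℝ × ℝ))).map (glueWith Λ · η)) ≤
      ∫⁻ σ, ‖Real.exp (-b * hamiltonianIn P.chainPotential chainSupp Λ σ)‖ₑ
        ∂((Measure.pi fun _ : Λ => (volume : Measure (ℝ × ℝ))).map (glueWith Λ · η)) := by
    refine lintegral_mono fun σ => ?_
    have h1 : (1 : ℝ) ≤ Real.exp (-b * hamiltonianIn P.chainPotential chainSupp Λ σ) :=
      Real.one_le_exp (hexp σ)
    have h0 : (0 : ℝ) ≤ Real.exp (-b * hamiltonianIn P.chainPotential chainSupp Λ σ) :=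
      (Real.exp_pos _).le
    rw [Real.enorm_eq_ofReal h0, ← ENNReal.ofReal_one]
    exact ENNReal.ofReal_le_ofReal h1
  rw [lintegral_one, map_glue_pi_volume_univ Λ hΛ η] at hge
  exact absurd (lt_of_le_of_lt hge hfin) (lt_irrefl _)

/-- **No chain has a Gibbs kernel at `T = 0`** on a non-empty volume: `P.chainSpecification 0 Λ η = 0`
(`0⁻¹ = 0`, weight `e⁰ = 1`, normaliser `∞`). A junk feature of the definition, harmless under the
`0 < T` guards of every thesis. [folklore] -/
theorem chainSpecification_zero_temp (P : OscillatorChain) (Λ : Finset ℤ) (hΛ : Λ.Nonempty)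
    (η : ChainConfig) : P.chainSpecification 0 Λ η = 0 := by
  show gibbsSpecOfPotential volume P.chainPotential chainSupp (0:ℝ)⁻¹ Λ η = 0
  rw [inv_zero]
  exact gibbsKernel_eq_zero_of_exponent_nonneg P 0 Λ hΛ η (fun σ => by simp)

/-- A DLR state cannot integrate a kernel vanishing in volume `{0}` to a probability. [folklore] -/
theorem not_isChainGibbsMeasure_of_kernel_zero (P : OscillatorChain) (T : ℝ)
    (h0 : ∀ η : ChainConfig, P.chainSpecification T {0} η = 0) (μ : Measure ChainConfig) :
    ¬ P.IsChainGibbsMeasure T μ := by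
  rintro ⟨hprob, hDLR⟩
  have h := hDLR {0} univ MeasurableSet.univ
  simp_rw [h0] at h
  simp only [Measure.coe_zero, Pi.zero_apply, lintegral_zero, measure_univ] at h
  exact zero_ne_one h

/-- **No chain has a DLR Gibbs state at temperature `0`.** [folklore] -/
theorem not_isChainGibbsMeasure_zero_temp (P : OscillatorChain) (μ : Measure ChainConfig) :
    ¬ P.IsChainGibbsMeasure 0 μ :=
  not_isChainGibbsMeasure_of_kernel_zero P 0
    (fun η => chainSpecification_zero_temp P {0} ⟨0, Finset.mem_singleton_self 0⟩ η) μ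

end OscillatorChain

/-- The finite-volume Hamiltonian of `pinnedChain` with non-negative couplings is `≥ 0`. [folklore] -/
theorem hamiltonianIn_pinnedChain_nonneg {ω₂ lam β : ℝ} (hω : 0 ≤ ω₂) (hl : 0 ≤ lam) (hβ : 0 ≤ β)
    (γ : ℝ) (Λ : Finset ℤ) (σ : ChainConfig) :
    0 ≤ hamiltonianIn (pinnedChain ω₂ lam β γ).chainPotential OscillatorChain.chainSupp Λ σ := by
  unfold hamiltonianIn
  refine Finset.sum_nonneg fun A _ => ?_
  simp only [OscillatorChain.chainPotential, pinnedChain]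
  refine add_nonneg (Finset.sum_nonneg fun x _ => ?_) (Finset.sum_nonneg fun x _ => ?_)
  · split_ifs
    · positivity
    · exact le_rfl
  · split_ifs
    · positivity
    · exact le_rfl

/-- **Negative temperatures are empty** for `pinnedChain` with `ω₂, lam, β ≥ 0`: the weight
`e^{-H/T} ≥ 1` is not normalisable. [folklore] -/
theorem chainSpecification_pinnedChain_neg_temp {ω₂ lam β : ℝ} (hω : 0 ≤ ω₂) (hl : 0 ≤ lam)
    (hβ : 0 ≤ β) (γ : ℝ) {T : ℝ} (hT : T < 0) (Λ : Finset ℤ) (hΛ : Λ.Nonempty) (η : ChainConfig) :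
    (pinnedChain ω₂ lam β γ).chainSpecification T Λ η = 0 := by
  show gibbsSpecOfPotential volume _ OscillatorChain.chainSupp T⁻¹ Λ η = 0
  refine OscillatorChain.gibbsKernel_eq_zero_of_exponent_nonneg _ _ Λ hΛ η fun σ => ?_
  have hTi : -T⁻¹ ≥ 0 := by
    have : T⁻¹ < 0 := inv_lt_zero.mpr hT
    linarith
  exact mul_nonneg hTi (hamiltonianIn_pinnedChain_nonneg hω hl hβ γ Λ σ)

/-- **A DLR state of `pinnedChain` (non-negative couplings) forces `0 < T`**: the temperature guard of
the witness predicate is already maximal. [folklore] -/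
theorem isChainGibbsMeasure_pinnedChain_temp_pos {ω₂ lam β γ T : ℝ} (hω : 0 ≤ ω₂) (hl : 0 ≤ lam)
    (hβ : 0 ≤ β) {μ : Measure ChainConfig} (hG : (pinnedChain ω₂ lam β γ).IsChainGibbsMeasure T μ) :
    0 < T := by
  by_contra hT
  rcases (not_lt.mp hT).eq_or_lt with h0 | hneg
  · exact OscillatorChain.not_isChainGibbsMeasure_zero_temp _ μ (h0 ▸ hG)
  · exact OscillatorChain.not_isChainGibbsMeasure_of_kernel_zero _ T
      (fun η => chainSpecification_pinnedChain_neg_temp hω hl hβ γ hneg {0}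
        ⟨0, Finset.mem_singleton_self 0⟩ η) μ hG

/-- Second, independent junk feature at `T = 0`: `(0²)⁻¹ = 0` makes the `T⁻²`-normalised Abel
functional identically `0`, which cannot tend to `κ > 0`. [folklore] -/
theorem not_tendsto_abel_zero_temp {P : OscillatorChain} (D : InfiniteChainDynamics P)
    (μ : Measure ChainConfig) {κ : ℝ} (hκ : 0 < κ) :
    ¬ Tendsto (fun ν : ℝ => ((0 : ℝ) ^ 2)⁻¹ * ∫ t in Ioi (0 : ℝ),
        Real.exp (-(ν * t)) * D.currentCorrelation μ t) (𝓝[>] (0 : ℝ)) (𝓝 κ) := by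
  intro h
  simp only [ne_eq, OfNat.ofNat_ne_zero, not_false_eq_true, zero_pow, inv_zero, zero_mul] at h
  exact hκ.ne' (tendsto_nhds_unique h tendsto_const_nhds)

/-! ## §2 DLR states are non-atomic on coordinates -/

/-- **DLR states charge no coordinate value**: `μ {σ | σ 0 = v} = 0` (the kernel in volume `{0}`
is absolutely continuous w.r.t. Lebesgue in the coordinate `σ 0`). [folklore] -/
theorem OscillatorChain.IsChainGibbsMeasure.measure_coord_eq_zero {P : OscillatorChain} {T : ℝ}
    {μ : Measure ChainConfig} (h : P.IsChainGibbsMeasure T μ) (v : ℝ × ℝ) :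
    μ {σ | σ 0 = v} = 0 := by
  obtain ⟨-, hDLR⟩ := h
  have hA : MeasurableSet {σ : ChainConfig | σ 0 = v} :=
    measurableSet_eq_fun (measurable_pi_apply 0) measurable_const
  rw [← hDLR {0} _ hA]
  have hker : ∀ η : ChainConfig, P.chainSpecification T {0} η {σ | σ 0 = v} = 0 := by
    intro η
    show gibbsSpecOfPotential volume P.chainPotential OscillatorChain.chainSupp T⁻¹ {0} η _ = 0
    simp only [gibbsSpecOfPotential]
    refine tilted_absolutelyContinuous _ _ ?_
    rw [Measure.map_apply (measurable_glueWith _ η) hA]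
    have hpre : (fun ζ : (({0} : Finset ℤ)) → ℝ × ℝ => glueWith {0} ζ η) ⁻¹' {σ | σ 0 = v} =
        Set.pi univ (fun _ => {v}) := by
      ext ζ
      simp only [mem_preimage, mem_setOf_eq, mem_univ_pi, mem_singleton_iff]
      constructor
      · intro hζ i
        obtain ⟨i, hi⟩ := i
        have hi0 : i = 0 := Finset.mem_singleton.mp hi
        subst hi0
        rwa [glueWith_apply_mem _ _ _ hi] at hζ
      · intro hζ
        rw [glueWith_apply_mem _ _ _ (Finset.mem_singleton_self 0)]
        exact hζ ⟨0, Finset.mem_singleton_self 0⟩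
    rw [hpre, Measure.pi_pi]
    apply Finset.prod_eq_zero (Finset.mem_univ ⟨0, Finset.mem_singleton_self 0⟩)
    rw [show ({v} : Set (ℝ × ℝ)) = {v.1} ×ˢ {v.2} by ext ⟨a, b⟩; simp [Prod.ext_iff],
      Measure.volume_eq_prod, Measure.prod_prod]
    simp
  simp_rw [hker]
  exact lintegral_zero

/-- No Dirac mass is a DLR state of any chain at any temperature. [folklore] -/
theorem OscillatorChain.not_isChainGibbsMeasure_dirac (P : OscillatorChain) (T : ℝ) (σ₀ : ChainConfig) :
    ¬ P.IsChainGibbsMeasure T (Measure.dirac σ₀) := by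
  intro h
  have h0 := h.measure_coord_eq_zero (σ₀ 0)
  rw [Measure.dirac_apply_of_mem (show σ₀ ∈ {σ : ChainConfig | σ 0 = σ₀ 0} from rfl)] at h0
  exact one_ne_zero h0

/-! ## §3 The interface is junk-inhabited, the witness is not -/

/-- The configuration at rest. [folklore] -/
def restConfig : ChainConfig := fun _ => (0, 0)

namespace OscillatorChain

/-- The REST DYNAMICS: carrier `{restConfig}`, identity flow — a genuine inhabitant of
`InfiniteChainDynamics P` for every chain with `U'(0) = 0` (the rest point is an equilibrium;
uniqueness inside the one-point carrier is trivial). [folklore] -/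
def restDynamics (P : OscillatorChain) (hU : deriv P.U 0 = 0) : InfiniteChainDynamics P where
  carrier := {restConfig}
  flow := fun _ σ => σ
  mapsTo := fun _ _ hσ => hσ
  flow_zero := fun _ _ => rfl
  isSolution := by
    intro σ hσ
    rw [mem_singleton_iff] at hσ
    subst hσ
    exact P.isSolution_const_zero hU
  unique := by
    intro c hc _ t
    show c t = c 0
    rw [mem_singleton_iff.mp (hc t), mem_singleton_iff.mp (hc 0)]

/-- The rest dynamics preserves the Dirac mass at rest. [folklore] -/
theorem restDynamics_preserves_dirac (P : OscillatorChain) (hU : deriv P.U 0 = 0) :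
    (P.restDynamics hU).PreservesMeasure (Measure.dirac restConfig) := by
  refine ⟨?_, fun t => ?_⟩
  · rw [ae_dirac_eq]
    show restConfig ∈ ({restConfig} : Set ChainConfig)
    exact mem_singleton restConfig
  · exact MeasurePreserving.id _

/-- The bond current vanishes at rest. [folklore] -/
@[simp] theorem bondCurrentZ_restConfig (P : OscillatorChain) (x : ℤ) :
    P.bondCurrentZ restConfig x = 0 := by
  simp [OscillatorChain.bondCurrentZ, restConfig]

/-- Current correlations of the rest dynamics in the Dirac state vanish identically. [folklore] -/
theorem currentCorrelation_restDynamics (P : OscillatorChain) (hU : deriv P.U 0 = 0) (t : ℝ) :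
    (P.restDynamics hU).currentCorrelation (Measure.dirac restConfig) t = 0 := by
  simp [InfiniteChainDynamics.currentCorrelation, integral_dirac]

/-- … and converge absolutely. [folklore] -/
theorem hasAbsConvergentCorrelation_restDynamics (P : OscillatorChain) (hU : deriv P.U 0 = 0)
    (t : ℝ) : (P.restDynamics hU).HasAbsConvergentCorrelation (Measure.dirac restConfig) t := by
  refine ⟨fun x => integrable_dirac (by simp), ?_⟩
  simp only [integral_dirac, bondCurrentZ_restConfig, zero_mul, abs_zero]
  exact summable_zero

/-- A constant curve solves the equations of motion only if all momenta vanish: the identity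
flow can carry only equilibria (a `μ`-null set for every DLR state, by `measure_coord_eq_zero`).
[folklore] -/
theorem momenta_zero_of_const_isSolution {P : OscillatorChain} {σ : ChainConfig}
    (h : P.IsSolution fun _ : ℝ => σ) (i : ℤ) : (σ i).2 = 0 := by
  have h1 := (h i 0).1
  have h2 : HasDerivAt (fun _ : ℝ => (σ i).1) 0 0 := hasDerivAt_const 0 _
  exact h1.unique h2

end OscillatorChain

/-- **LAX WITNESSES EXIST AT EVERY `T`** for every chain with `U'(0) = 0`: weaken "Gibbs state" to
"probability measure" and `0 < κ` to `0 ≤ κ`, and the Dirac mass at rest with the rest dynamics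
is a witness (`C ≡ 0`, `κ = 0`). Both clauses of the witness predicate are therefore
load-bearing; the Dirac state is excluded exactly by `not_isChainGibbsMeasure_dirac`. [folklore] -/
theorem exists_laxAbelWitness (P : OscillatorChain) (hU : deriv P.U 0 = 0) (T : ℝ) :
    ∃ (μ : Measure ChainConfig) (D : InfiniteChainDynamics P) (κ : ℝ),
      IsProbabilityMeasure μ ∧ D.PreservesMeasure μ ∧
        (∀ t : ℝ, D.HasAbsConvergentCorrelation μ t) ∧ 0 ≤ κ ∧
          Tendsto (fun ν : ℝ => (T ^ 2)⁻¹ * ∫ t in Ioi (0 : ℝ),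
            Real.exp (-(ν * t)) * D.currentCorrelation μ t) (𝓝[>] (0 : ℝ)) (𝓝 κ) := by
  refine ⟨Measure.dirac restConfig, P.restDynamics hU, 0, inferInstance,
    P.restDynamics_preserves_dirac hU, P.hasAbsConvergentCorrelation_restDynamics hU, le_rfl, ?_⟩
  simp only [OscillatorChain.currentCorrelation_restDynamics, mul_zero, integral_zero]
  exact tendsto_const_nhds

/-- `U'(0) = 0` for `pinnedChain` (so `restDynamics` applies to the conjunct's chain). [folklore] -/
theorem deriv_U_pinnedChain_zero (ω₂ lam β γ : ℝ) : deriv (pinnedChain ω₂ lam β γ).U 0 = 0 := by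
  have h : HasDerivAt (fun q : ℝ => ω₂ * q ^ 2 / 2 + lam * q ^ 4 / 4)
      (ω₂ * (2 * (0:ℝ) ^ 1 * 1) / 2 + lam * (4 * (0:ℝ) ^ 3 * 1) / 4) 0 :=
    ((((hasDerivAt_id (0:ℝ)).pow 2).const_mul ω₂).div_const 2).add
      ((((hasDerivAt_id (0:ℝ)).pow 4).const_mul lam).div_const 4)
  rw [show (pinnedChain ω₂ lam β γ).U = fun q : ℝ => ω₂ * q ^ 2 / 2 + lam * q ^ 4 / 4 from rfl,
    h.deriv]
  ring

/-- Empty carrier: `PreservesMeasure` forces `μ = 0` (not a probability). [folklore] -/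
theorem InfiniteChainDynamics.measure_eq_zero_of_carrier_empty {P : OscillatorChain}
    (D : InfiniteChainDynamics P) (hD : D.carrier = ∅) {μ : Measure ChainConfig}
    (h : D.PreservesMeasure μ) : μ = 0 := by
  obtain ⟨hae, -⟩ := h
  rw [hD] at hae
  simp only [mem_empty_iff_false, eventually_false_iff_eq_bot, ae_eq_bot] at hae
  exact hae

/-! ## §4 Obstructions to the Abel limit -/

/-- `C ≡ 0` (e.g. every junk making the `tsum`/Bochner objects `0`): no `κ > 0` is the Abel limit.
[folklore] -/
theorem not_tendsto_abel_of_correlation_zero {P : OscillatorChain} (D : InfiniteChainDynamics P)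
    (μ : Measure ChainConfig) (T : ℝ) (hC : ∀ t : ℝ, D.currentCorrelation μ t = 0) {κ : ℝ}
    (hκ : 0 < κ) :
    ¬ Tendsto (fun ν : ℝ => (T ^ 2)⁻¹ * ∫ t in Ioi (0 : ℝ),
        Real.exp (-(ν * t)) * D.currentCorrelation μ t) (𝓝[>] (0 : ℝ)) (𝓝 κ) := by
  intro h
  simp only [hC, mul_zero, integral_zero] at h
  exact hκ.ne' (tendsto_nhds_unique h tendsto_const_nhds)

/-- NON-INTEGRABLE `t ↦ e^{-νt}C(t)` for all small `ν`: the Bochner integral is the junk `0`, so no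
`κ > 0` is a limit. A witness therefore owes (ae-strong) measurability of `t ↦ C(t)` and
integrability of `e^{-νt}C(t)` on `(0, ∞)`; `InfiniteChainDynamics` has no joint-measurability
field supplying it. [folklore] -/
theorem not_tendsto_abel_of_junk_integral {P : OscillatorChain} (D : InfiniteChainDynamics P)
    (μ : Measure ChainConfig) (T : ℝ)
    (hC : ∀ᶠ ν in 𝓝[>] (0 : ℝ),
      ¬ IntegrableOn (fun t : ℝ => Real.exp (-(ν * t)) * D.currentCorrelation μ t) (Ioi 0))
    {κ : ℝ} (hκ : 0 < κ) :
    ¬ Tendsto (fun ν : ℝ => (T ^ 2)⁻¹ * ∫ t in Ioi (0 : ℝ),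
        Real.exp (-(ν * t)) * D.currentCorrelation μ t) (𝓝[>] (0 : ℝ)) (𝓝 κ) := by
  intro h
  have h0 : Tendsto (fun ν : ℝ => (T ^ 2)⁻¹ * ∫ t in Ioi (0 : ℝ),
      Real.exp (-(ν * t)) * D.currentCorrelation μ t) (𝓝[>] (0 : ℝ)) (𝓝 0) := by
    refine (tendsto_const_nhds (x := (0 : ℝ))).congr' ?_
    filter_upwards [hC] with ν hν
    rw [integral_undef hν, mul_zero]
  exact hκ.ne' (tendsto_nhds_unique h h0)

/-- **DRUDE FLOOR ⇒ DIVERGENCE** (Mazur 1969 / kill criterion "atom at frequency 0"): if a real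
function `A` of the regularisation parameter dominates `d e^{-ν t₀}/ν - M` on `(0, 1]` with `d > 0`
— the lower bound that a floor `C(t) ≥ d` for `t ≥ t₀` produces for `∫₀^∞ e^{-νt}C` — then `A`
has no finite limit at `ν ↓ 0`. Ballistic pairs REFUTE witnesses; they never fake them. [folklore] -/
theorem not_tendsto_of_drude_floor {A : ℝ → ℝ} {d t₀ M : ℝ} (hd : 0 < d)
    (hA : ∀ ν : ℝ, 0 < ν → ν ≤ 1 → d * Real.exp (-(ν * t₀)) / ν - M ≤ A ν) (κ : ℝ) :
    ¬ Tendsto A (𝓝[>] (0 : ℝ)) (𝓝 κ) := by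
  intro hlim
  have hlow : Tendsto (fun ν : ℝ => d * Real.exp (-(ν * t₀)) / ν - M) (𝓝[>] (0 : ℝ)) atTop := by
    have h1 : Tendsto (fun ν : ℝ => d * Real.exp (-(ν * t₀))) (𝓝[>] (0 : ℝ)) (𝓝 (d * 1)) := by
      refine Tendsto.const_mul d ?_
      have : Tendsto (fun ν : ℝ => Real.exp (-(ν * t₀))) (𝓝 (0 : ℝ)) (𝓝 (Real.exp (-(0 * t₀)))) :=
        ((continuous_neg.comp (continuous_id.mul continuous_const)).tendsto 0 |>
          Real.continuous_exp.continuousAt.tendsto.comp)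
      simp only [zero_mul, neg_zero, Real.exp_zero] at this
      exact this.mono_left nhdsWithin_le_nhds
    rw [mul_one] at h1
    have h2 : Tendsto (fun ν : ℝ => ν⁻¹) (𝓝[>] (0 : ℝ)) atTop := tendsto_inv_nhdsGT_zero
    have h3 : Tendsto (fun ν : ℝ => d * Real.exp (-(ν * t₀)) * ν⁻¹) (𝓝[>] (0 : ℝ)) atTop :=
      Tendsto.pos_mul_atTop hd h1 h2
    simp_rw [← div_eq_mul_inv] at h3
    exact tendsto_atTop_add_const_right _ (-M) h3 |>.congr (fun ν => by ring)
  have hev : ∀ᶠ ν in 𝓝[>] (0 : ℝ), d * Real.exp (-(ν * t₀)) / ν - M ≤ A ν := by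
    have : ∀ᶠ ν in 𝓝[>] (0 : ℝ), ν ∈ Ioc (0 : ℝ) 1 := Ioc_mem_nhdsGT one_pos
    filter_upwards [this] with ν hν using hA ν hν.1 hν.2
  have hAtop : Tendsto A (𝓝[>] (0 : ℝ)) atTop := tendsto_atTop_mono' _ hev hlow
  exact not_tendsto_nhds_of_tendsto_atTop hAtop κ hlim

/-- The Poisson/Abel kernel integrated against a Dirac mass. [folklore] -/
theorem integral_poisson_dirac (a ν : ℝ) :
    ∫ ω, ν / (ν ^ 2 + ω ^ 2) ∂(Measure.dirac a) = ν / (ν ^ 2 + a ^ 2) := by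
  rw [integral_dirac]

/-- **ABEL LIMITS ARE NOT WEAKLY CLOSED** without an equi-modulus: `σ_n = δ_{1/(n+1)} ⇀ δ_0`, each
`σ_n` has Abel limit `lim_{ν↓0} ∫ ν/(ν²+ω²) dσ_n = 0`, but `∫ ν/(ν²+ω²) dδ_0 = 1/ν` has no finite
limit (the weak limit point carries an atom AT `0`, i.e. a Drude weight). A continuity/closedness
argument along a parameter must control the RATE of the `ν ↓ 0` limit uniformly. [folklore] -/
theorem abelLimit_not_weakly_closed :
    ∃ (σ : ℕ → Measure ℝ) (σ' : Measure ℝ),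
      (∀ n, IsFiniteMeasure (σ n)) ∧ IsFiniteMeasure σ' ∧
      (∀ g : ℝ → ℝ, Continuous g →
        Tendsto (fun n => ∫ x, g x ∂σ n) atTop (𝓝 (∫ x, g x ∂σ'))) ∧
      (∀ n, Tendsto (fun ν : ℝ => ∫ ω, ν / (ν ^ 2 + ω ^ 2) ∂σ n) (𝓝[>] (0 : ℝ)) (𝓝 0)) ∧
      ¬ ∃ L : ℝ, Tendsto (fun ν : ℝ => ∫ ω, ν / (ν ^ 2 + ω ^ 2) ∂σ') (𝓝[>] (0 : ℝ)) (𝓝 L) := by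
  refine ⟨fun n => Measure.dirac (1 / ((n : ℝ) + 1)), Measure.dirac 0, fun n => inferInstance,
    inferInstance, ?_, ?_, ?_⟩
  · intro g hg
    simp only [integral_dirac]
    exact (hg.tendsto 0).comp tendsto_one_div_add_atTop_nhds_zero_nat
  · intro n
    simp only [integral_poisson_dirac]
    have hcont : Continuous fun ν : ℝ => ν / (ν ^ 2 + (1 / ((n : ℝ) + 1)) ^ 2) := by
      refine Continuous.div continuous_id (by fun_prop) fun ν => ?_
      have : (0 : ℝ) < (1 / ((n : ℝ) + 1)) ^ 2 := by positivity
      nlinarith [sq_nonneg ν]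
    have h := hcont.tendsto 0
    simp only [zero_div] at h
    exact h.mono_left nhdsWithin_le_nhds
  · rintro ⟨L, hL⟩
    simp only [integral_poisson_dirac] at hL
    have hinv : Tendsto (fun ν : ℝ => ν / (ν ^ 2 + (0 : ℝ) ^ 2)) (𝓝[>] (0 : ℝ)) atTop := by
      refine (tendsto_inv_nhdsGT_zero (𝕜 := ℝ)).congr' ?_
      filter_upwards [self_mem_nhdsWithin] with ν hν
      have hν' : (ν : ℝ) ≠ 0 := (mem_Ioi.mp hν).ne'
      field_simp
      ring
    exact not_tendsto_nhds_of_tendsto_atTop hinv L hL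

/-! ## §5 Abel summation -/

/-- **Abel summation of an `L¹` function**: `∫₀^∞ e^{-νt}C(t)dt → ∫₀^∞ C` as `ν ↓ 0` (dominated
convergence, bound `|C|`). [folklore] -/
theorem tendsto_abel_of_integrableOn {C : ℝ → ℝ} (hC : IntegrableOn C (Ioi 0)) :
    Tendsto (fun ν : ℝ => ∫ t in Ioi (0 : ℝ), Real.exp (-(ν * t)) * C t) (𝓝[>] (0 : ℝ))
      (𝓝 (∫ t in Ioi (0 : ℝ), C t)) := by
  refine tendsto_integral_filter_of_dominated_convergence (fun t => ‖C t‖) ?_ ?_ hC.norm ?_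
  · refine Eventually.of_forall fun ν => ?_
    exact ((Real.continuous_exp.comp (continuous_const.mul continuous_id).neg).aestronglyMeasurable).mul
      hC.aestronglyMeasurable
  · have : ∀ᶠ ν in 𝓝[>] (0 : ℝ), 0 < ν := eventually_mem_nhdsWithin
    filter_upwards [this] with ν hν
    filter_upwards [ae_restrict_mem measurableSet_Ioi] with t ht
    rw [norm_mul, Real.norm_eq_abs, abs_of_pos (Real.exp_pos _)]
    have ht' : (0 : ℝ) < t := ht
    have : Real.exp (-(ν * t)) ≤ 1 :=
      Real.exp_le_one_iff.mpr (neg_nonpos.mpr (mul_nonneg hν.le ht'.le))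
    exact mul_le_of_le_one_left (norm_nonneg _) this
  · refine Eventually.of_forall fun t => ?_
    have h1 : Tendsto (fun ν : ℝ => Real.exp (-(ν * t)) * C t) (𝓝 (0 : ℝ))
        (𝓝 (Real.exp (-(0 * t)) * C t)) :=
      ((Real.continuous_exp.comp (continuous_id.mul continuous_const).neg).mul continuous_const).tendsto 0
    simp only [zero_mul, neg_zero, Real.exp_zero, one_mul] at h1
    exact h1.mono_left nhdsWithin_le_nhds

/-- **An `L¹` Green–Kubo pair is an Abelian witness**: under `HasGreenKubo μ T` the
`T⁻²`-normalised Abel functional tends to `κ_GK(T) > 0` (BLR 2000 §6.3 (35) ↔ §7 (37)).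
[cite: BonettoLebowitzReyBellet2000, §6.3 eq. (35) and §7 eq. (37)] -/
theorem InfiniteChainDynamics.HasGreenKubo.tendsto_abel {P : OscillatorChain}
    {D : InfiniteChainDynamics P} {μ : Measure ChainConfig} {T : ℝ} (h : D.HasGreenKubo μ T) :
    Tendsto (fun ν : ℝ => (T ^ 2)⁻¹ * ∫ t in Ioi (0 : ℝ),
        Real.exp (-(ν * t)) * D.currentCorrelation μ t) (𝓝[>] (0 : ℝ))
      (𝓝 (D.greenKuboConductivity μ T)) :=
  (tendsto_abel_of_integrableOn h.2.1).const_mul ((T ^ 2)⁻¹)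

/-! ## §6 Only `U, V` matter (the bath constant is decoration in infinite volume) -/

namespace OscillatorChain

/-- Two chains with the same potentials have the same forces. [folklore] -/
theorem force_eq_of_UV {P P' : OscillatorChain} (hU : P.U = P'.U) (hV : P.V = P'.V) :
    P.force = P'.force := by
  funext σ i
  simp only [OscillatorChain.force, OscillatorChain.interactionForce, hU, hV]

/-- … and the same solutions. [folklore] -/
theorem isSolution_iff_of_UV {P P' : OscillatorChain} (hU : P.U = P'.U) (hV : P.V = P'.V)
    (c : ℝ → ChainConfig) : P.IsSolution c ↔ P'.IsSolution c := by
  unfold OscillatorChain.IsSolution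
  rw [force_eq_of_UV hU hV]

/-- Transport of an infinite-volume dynamics between chains with the same potentials (e.g.
`pinnedChain ω₂ lam β γ` and `pinnedChain ω₂ lam β γ'`). [folklore] -/
def transportUV {P P' : OscillatorChain} (hU : P.U = P'.U) (hV : P.V = P'.V)
    (D : InfiniteChainDynamics P) : InfiniteChainDynamics P' where
  carrier := D.carrier
  flow := D.flow
  mapsTo := D.mapsTo
  flow_zero := D.flow_zero
  isSolution := fun σ hσ => (isSolution_iff_of_UV hU hV _).1 (D.isSolution σ hσ)
  unique := fun c hc hsol => D.unique c hc ((isSolution_iff_of_UV hU hV c).2 hsol)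

/-- Same `V`, same bond currents. [folklore] -/
theorem bondCurrentZ_eq_of_V {P P' : OscillatorChain} (hV : P.V = P'.V) :
    P.bondCurrentZ = P'.bondCurrentZ := by
  funext σ x; simp only [OscillatorChain.bondCurrentZ, hV]

/-- The transported dynamics has the same current correlations … [folklore] -/
theorem currentCorrelation_transportUV {P P' : OscillatorChain} (hU : P.U = P'.U) (hV : P.V = P'.V)
    (D : InfiniteChainDynamics P) (μ : Measure ChainConfig) (t : ℝ) :
    (transportUV hU hV D).currentCorrelation μ t = D.currentCorrelation μ t := by
  simp only [InfiniteChainDynamics.currentCorrelation, transportUV, bondCurrentZ_eq_of_V hV]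

/-- … the same absolute convergence … [folklore] -/
theorem hasAbsConvergentCorrelation_transportUV_iff {P P' : OscillatorChain} (hU : P.U = P'.U)
    (hV : P.V = P'.V) (D : InfiniteChainDynamics P) (μ : Measure ChainConfig) (t : ℝ) :
    (transportUV hU hV D).HasAbsConvergentCorrelation μ t ↔ D.HasAbsConvergentCorrelation μ t := by
  simp only [InfiniteChainDynamics.HasAbsConvergentCorrelation, transportUV, bondCurrentZ_eq_of_V hV]

/-- … the same invariant measures … [folklore] -/
theorem preservesMeasure_transportUV_iff {P P' : OscillatorChain} (hU : P.U = P'.U)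
    (hV : P.V = P'.V) (D : InfiniteChainDynamics P) (μ : Measure ChainConfig) :
    (transportUV hU hV D).PreservesMeasure μ ↔ D.PreservesMeasure μ := Iff.rfl

/-- … and the two chains have the same Gibbs kernels … [folklore] -/
theorem chainSpecification_eq_of_UV {P P' : OscillatorChain} (hU : P.U = P'.U) (hV : P.V = P'.V) :
    P.chainSpecification = P'.chainSpecification := by
  have hΦ : P.chainPotential = P'.chainPotential := by
    funext A σ; simp only [OscillatorChain.chainPotential, hU, hV]
  funext T
  simp only [OscillatorChain.chainSpecification, hΦ]

/-- … hence the same DLR states. [folklore] -/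
theorem isChainGibbsMeasure_iff_of_UV {P P' : OscillatorChain} (hU : P.U = P'.U) (hV : P.V = P'.V)
    (T : ℝ) (μ : Measure ChainConfig) : P.IsChainGibbsMeasure T μ ↔ P'.IsChainGibbsMeasure T μ := by
  simp only [OscillatorChain.IsChainGibbsMeasure, chainSpecification_eq_of_UV hU hV]

end OscillatorChain

/-- **THE BATH CONSTANT IS DECORATION for the Abelian witness of `pinnedChain`**: a witness at
bath constant `γ` is a witness at any `γ'` (same state, transported dynamics, same `κ`). [folklore] -/
theorem abelWitness_pinnedChain_gamma_transport {ω₂ lam β T : ℝ} (γ γ' : ℝ)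
    (h : ∃ (μ : Measure ChainConfig) (D : InfiniteChainDynamics (pinnedChain ω₂ lam β γ)) (κ : ℝ),
      (pinnedChain ω₂ lam β γ).IsChainGibbsMeasure T μ ∧ D.PreservesMeasure μ ∧
        (∀ t : ℝ, D.HasAbsConvergentCorrelation μ t) ∧ 0 < κ ∧
          Tendsto (fun ν : ℝ => (T ^ 2)⁻¹ * ∫ t in Ioi (0 : ℝ),
            Real.exp (-(ν * t)) * D.currentCorrelation μ t) (𝓝[>] (0 : ℝ)) (𝓝 κ)) :
    ∃ (μ : Measure ChainConfig) (D : InfiniteChainDynamics (pinnedChain ω₂ lam β γ')) (κ : ℝ),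
      (pinnedChain ω₂ lam β γ').IsChainGibbsMeasure T μ ∧ D.PreservesMeasure μ ∧
        (∀ t : ℝ, D.HasAbsConvergentCorrelation μ t) ∧ 0 < κ ∧
          Tendsto (fun ν : ℝ => (T ^ 2)⁻¹ * ∫ t in Ioi (0 : ℝ),
            Real.exp (-(ν * t)) * D.currentCorrelation μ t) (𝓝[>] (0 : ℝ)) (𝓝 κ) := by
  have hU : (pinnedChain ω₂ lam β γ).U = (pinnedChain ω₂ lam β γ').U := rfl
  have hV : (pinnedChain ω₂ lam β γ).V = (pinnedChain ω₂ lam β γ').V := rfl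
  obtain ⟨μT, D, κ, hG, hP, hAC, hκ, hlim⟩ := h
  refine ⟨μT, OscillatorChain.transportUV hU hV D, κ,
    (OscillatorChain.isChainGibbsMeasure_iff_of_UV hU hV T μT).1 hG,
    (OscillatorChain.preservesMeasure_transportUV_iff hU hV D μT).2 hP,
    fun t => (OscillatorChain.hasAbsConvergentCorrelation_transportUV_iff hU hV D μT t).2 (hAC t), hκ, ?_⟩
  simp only [OscillatorChain.currentCorrelation_transportUV]
  exact hlim

end Literature.MathematicalPhysics.KineticTheory.HeatConduction

end
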